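import Mathlib.Topology.Instances.ZMod
import Literature.AnabelianGeometry.AbsoluteAnabelian.AbsTopISemiAbsolute
import Literature.AnabelianGeometry.AbsoluteAnabelian.MLFGaloisGroupsProofs
import Literature.AnabelianGeometry.AbsoluteAnabelian.GaloisSubextensionProofs
import Literature.AnabelianGeometry.AbsoluteAnabelian.ProfiniteRankProofs
import HarnessLib

/-!
# [AbsTopI] Thm 2.6 (ii): the clauses about `G` and `ε¹_p(Π) = ∞`, deduced from the rank formula

S. Mochizuki, *Topics in Absolute Anabelian Geometry I: Generalities* (2012) [AbsTopI], Thm 2.6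
(ii) p. 21 (manuscript pagination, lit key paper:url-11ac98ba15fc), `k` an MLF of residue
characteristic `p`: "`δ¹_l(G) = 1` if `l ≠ p`, `δ¹_p(G) = [k : ℚ_p] + 1`; [...] `ε¹_p(Π) = ∞`"
(`ε¹_p(Π)` = the supremum of the `δ¹_p(J)` over the open subgroups `J ⊆ Π`, defined in Thm
2.6).  abc-iut-L4-t4 typed the
item as the predicate `FundamentalExtension.Thm26ii B S` on an extension `1 → Δ → Π → G → 1` with
MLF base data `B` (`G ≅ G_k`), and its `G`-part as the closed named fact
`FundamentalExtension.thm26_ii_delta_gal` (the rank formula `hR`, local class field theory).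

This proof-only file DEDUCES, for ALL abstract extensions with MLF base data and GIVEN `hR`:

* `FundamentalExtension.freeProlRank_gal_of_rank` — the two `G`-clauses of `Thm26ii`
  (transport of `hR` along `G ≅ G_k`);
* `exists_isOpen_le_freeProlRank_absoluteGaloisGroup` — for every `n` an open subgroup
  `U ⊆ G_k` with `n ≤ δ¹_p(U)`: a continuous surjection `G_k ↠ ℤ_p` (which exists as
  `δ¹_p(G_k) ≥ 1`) followed by `ℤ_p ↠ ℤ/pⁿ` has open kernel `U = Gal(k̄/k′)` of index `pⁿ`, and
  `δ¹_p(U) = δ¹_p(G_{k′}) = [k′ : ℚ_p] + 1 = pⁿ[k : ℚ_p] + 1 > n` by `hR` for the MLF `k′`;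
* `FundamentalExtension.exists_isOpen_le_freeProlRank_of_rank` — hence "`ε¹_p(Π) = ∞`", the last
  clause of `Thm26ii`, by pulling `U` back along `Π ↠ G ≅ G_k` (`δ¹_p` does not decrease along a
  continuous surjection);
* `FundamentalExtension.thm26ii_of_rank` — so `Thm26ii B S` REDUCES, given `hR`, to its three
  clauses about `Π` (topological finite generation; `δ¹_l(Π) = δ¹_l(G)` off `Σ`; constancy on `Σ`).

The unconditional forms (feeding abc-iut-L4-t4's theorem `thm26_ii_delta_gal_holds`) are one-line
corollaries recorded with the other rewirings.  Proof-only; HONEST FRAMING: classical profinite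
group theory + local class field theory as a named input; no bearing on [IUTchIII] Cor. 3.12.
-/

noncomputable section

open Topology Field

namespace Literature.AnabelianGeometry.AbsoluteAnabelian

universe u

/-! ### A continuous surjection onto `ℤ_l` from `δ¹_l ≥ 1` -/

section RankOne

variable {G : Type u} [Group G] [TopologicalSpace G]

/-- If `δ¹_l(G) ≥ 1` then `G` surjects continuously onto `ℤ_l`: a continuous surjection onto
`ℤ_lⁿ`, `n ≥ 1`, followed by a coordinate projection. [cite: MochizukiAbsTopI2012, Thm 2.6 p.21] -/
theorem exists_surjective_padicInt_of_one_le_freeProlRank (l : ℕ) [Fact l.Prime]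
    (h : 1 ≤ freeProlRank G l) :
    ∃ f : G →ₜ* Multiplicative ℤ_[l], Function.Surjective f := by
  by_contra hne
  push Not at hne
  have h0 : freeProlRank G l ≤ 0 := by
    unfold freeProlRank
    refine iSup₂_le fun n hn => ?_
    obtain ⟨f, hf⟩ := hn
    rcases Nat.eq_zero_or_pos n with rfl | hpos
    · simp
    · exfalso
      let ev : Multiplicative (Fin n → ℤ_[l]) →* Multiplicative ℤ_[l] :=
        (Pi.evalAddMonoidHom (fun _ : Fin n => ℤ_[l]) ⟨0, hpos⟩).toMultiplicative
      have hev : Continuous ev :=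
        continuous_ofAdd.comp ((continuous_apply (⟨0, hpos⟩ : Fin n)).comp continuous_toAdd)
      have hevs : Function.Surjective ev := fun y =>
        ⟨Multiplicative.ofAdd (fun _ => Multiplicative.toAdd y), rfl⟩
      exact hne ⟨ev.comp f.toMonoidHom, hev.comp f.continuous_toFun⟩ (hevs.comp hf)
  have : (1 : ℕ∞) ≤ 0 := h.trans h0
  exact absurd this (by simp)

end RankOne

/-! ### Open subgroups of `G_k` of large `δ¹_p` -/

section Local

/-- `ℤ_p → ℤ/pⁿ` is continuous (discrete target): its kernel `pⁿℤ_p` is a ball. [folklore] -/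
private theorem continuous_toZModPow' (p : ℕ) [Fact p.Prime] (n : ℕ) :
    Continuous (PadicInt.toZModPow n : ℤ_[p] → ZMod (p ^ n)) := by
  refine continuous_of_continuousAt_zero (PadicInt.toZModPow n) ?_
  rw [ContinuousAt, map_zero, nhds_discrete (ZMod (p ^ n)), Filter.tendsto_pure]
  have hb : Metric.closedBall (0 : ℤ_[p]) ((p : ℝ) ^ (-n : ℤ)) ∈ 𝓝 (0 : ℤ_[p]) :=
    Metric.closedBall_mem_nhds _ (zpow_pos (by exact_mod_cast (Fact.out : p.Prime).pos) _)
  filter_upwards [hb] with x hx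
  rw [Metric.mem_closedBall, dist_zero_right, PadicInt.norm_le_pow_iff_mem_span_pow,
    ← PadicInt.ker_toZModPow, RingHom.mem_ker] at hx
  exact hx

/-- A topological group with a continuous surjection onto `ℤ_p` has, for every `n`, an open normal
subgroup of index `pⁿ` (the kernel of `G ↠ ℤ_p ↠ ℤ/pⁿ`). [folklore] -/
private theorem exists_isOpen_index_eq_pow_of_surjective {G : Type u} [Group G] [TopologicalSpace G]
    (p : ℕ) [Fact p.Prime] (f : G →ₜ* Multiplicative ℤ_[p]) (hf : Function.Surjective f) (n : ℕ) :
    ∃ U : Subgroup G, U.Normal ∧ IsOpen (U : Set G) ∧ U.index = p ^ n := by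
  let red : Multiplicative ℤ_[p] →* Multiplicative (ZMod (p ^ n)) :=
    (PadicInt.toZModPow n : ℤ_[p] →+* ZMod (p ^ n)).toAddMonoidHom.toMultiplicative
  have hred : Continuous red :=
    continuous_ofAdd.comp ((continuous_toZModPow' p n).comp continuous_toAdd)
  have hreds : Function.Surjective red := fun y => by
    obtain ⟨x, hx⟩ := ZMod.ringHom_surjective (PadicInt.toZModPow n) (Multiplicative.toAdd y)
    exact ⟨Multiplicative.ofAdd x, by
      change Multiplicative.ofAdd (PadicInt.toZModPow n x) = y
      rw [hx]
      rfl⟩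
  let g : G →* Multiplicative (ZMod (p ^ n)) := red.comp f.toMonoidHom
  have hg : Continuous g := hred.comp f.continuous_toFun
  have hgs : Function.Surjective g := hreds.comp hf
  refine ⟨g.ker, inferInstance, ?_, ?_⟩
  · have : IsOpen (g ⁻¹' {1}) := (isOpen_discrete {(1 : Multiplicative (ZMod (p ^ n)))}).preimage hg
    exact this
  · rw [Subgroup.index_ker, MonoidHom.range_eq_top.mpr hgs, Subgroup.card_top,
      Nat.card_congr Multiplicative.toAdd, Nat.card_zmod]

variable (K : Type) [Field K] [CharZero K]

/-- `[E : K] = [Gal(K̄/K) : Gal(K̄/E)]` for a subextension `E ⊆ K̄` (index taken in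
`Field.absoluteGaloisGroup K`). [folklore] -/
private theorem finrank_eq_index_comap' (E : IntermediateField K (AlgebraicClosure K)) :
    Module.finrank K E =
      (E.fixingSubgroup.comap (absoluteGaloisGroup.toAlgEquiv K).toMonoidHom).index := by
  rw [IntermediateField.finrank_eq_fixingSubgroup_index,
    Subgroup.index_comap_of_surjective _ (absoluteGaloisGroup.toAlgEquiv K).surjective]

/-- **Open subgroups of `G_k` of large `δ¹_p`** ([AbsTopI] Thm 2.6 (ii) "`ε¹_p(Π) = ∞`", the
`G_k`-level statement), GIVEN the LCFT rank formula `hR`: for `k` a finite extension of `ℚ_p` and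
every `n`, there is an open subgroup `U ⊆ G_k` with `n ≤ δ¹_p(U)` — namely `U = Gal(k̄/k′)` with
`[k′ : k] = pⁿ`, for which `δ¹_p(U) = δ¹_p(G_{k′}) = pⁿ[k : ℚ_p] + 1`.
[cite: MochizukiAbsTopI2012, Thm 2.6 (ii) p.21] -/
theorem exists_isOpen_le_freeProlRank_absoluteGaloisGroup
    (hR : ∀ (p : ℕ) [Fact p.Prime] (K : Type) [Field K] [Algebra ℚ_[p] K]
      [FiniteDimensional ℚ_[p] K],
      (∀ (l : ℕ) [Fact l.Prime], l ≠ p → freeProlRank (absoluteGaloisGroup K) l = 1) ∧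
        freeProlRank (absoluteGaloisGroup K) p = (Module.finrank ℚ_[p] K + 1 : ℕ))
    (p : ℕ) [Fact p.Prime] (K : Type) [Field K] [Algebra ℚ_[p] K] [FiniteDimensional ℚ_[p] K]
    (n : ℕ) :
    ∃ U : Subgroup (absoluteGaloisGroup K), IsOpen (U : Set (absoluteGaloisGroup K)) ∧
      (n : ℕ∞) ≤ freeProlRank U p := by
  haveI : CharZero K := charZero_of_injective_algebraMap (algebraMap ℚ_[p] K).injective
  -- a continuous surjection `G_K ↠ ℤ_p` (`δ¹_p(G_K) = [K:ℚ_p] + 1 ≥ 1`)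
  have h1 : (1 : ℕ∞) ≤ freeProlRank (absoluteGaloisGroup K) p := by
    rw [(hR p K).2]
    exact_mod_cast Nat.le_add_left 1 _
  obtain ⟨f, hf⟩ := exists_surjective_padicInt_of_one_le_freeProlRank p h1
  -- its composite with `ℤ_p ↠ ℤ/pⁿ` has open kernel `U` of index `pⁿ`
  obtain ⟨U, -, hUopen, hUidx⟩ := exists_isOpen_index_eq_pow_of_surjective p f hf n
  refine ⟨U, hUopen, ?_⟩
  -- `U = Gal(K̄/L)`, `[L : K] = pⁿ`
  obtain ⟨L, hLfin, -, hLU⟩ := exists_intermediateField_of_isOpen_absoluteGaloisGroup K U hUopen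
  haveI := hLfin
  haveI : FiniteDimensional ℚ_[p] L := Module.Finite.trans K L
  have hdegL : Module.finrank K L = p ^ n := by
    rw [finrank_eq_index_comap' K L, hLU, hUidx]
  have hdeg : Module.finrank ℚ_[p] L = Module.finrank ℚ_[p] K * p ^ n := by
    rw [← hdegL, Module.finrank_mul_finrank]
  -- `δ¹_p(U) = δ¹_p(G_L) = [L : ℚ_p] + 1`
  obtain ⟨e⟩ := nonempty_continuousMulEquiv_fixingSubgroup K L
  rw [hLU] at e
  rw [freeProlRank_eq_of_continuousMulEquiv e p, (hR p L).2, hdeg]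
  -- `n ≤ [K : ℚ_p]·pⁿ + 1`
  have hK : 0 < Module.finrank ℚ_[p] K := Module.finrank_pos
  have hlt : n < p ^ n := Nat.lt_pow_self (Fact.out : p.Prime).one_lt
  have : n ≤ Module.finrank ℚ_[p] K * p ^ n + 1 := by nlinarith
  exact_mod_cast this

end Local

/-! ### The clauses of `Thm26ii` about `G` and `ε¹_p(Π)`, for abstract extensions -/

namespace FundamentalExtension

variable {E : FundamentalExtension.{0}} (B : E.MLFBase)

/-- [AbsTopI] Thm 2.6 (ii), the `G`-clauses "`δ¹_l(G) = 1` if `l ≠ p`, `δ¹_p(G) = [k : ℚ_p] + 1`"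
for ANY extension with MLF base data `G ≅ G_k`, GIVEN the rank formula `hR` for `G_k` (transport
along the isomorphism). [cite: MochizukiAbsTopI2012, Thm 2.6 (ii) p.21] -/
theorem freeProlRank_gal_of_rank
    (hR : ∀ (p : ℕ) [Fact p.Prime] (K : Type) [Field K] [Algebra ℚ_[p] K]
      [FiniteDimensional ℚ_[p] K],
      (∀ (l : ℕ) [Fact l.Prime], l ≠ p → freeProlRank (absoluteGaloisGroup K) l = 1) ∧
        freeProlRank (absoluteGaloisGroup K) p = (Module.finrank ℚ_[p] K + 1 : ℕ)) :
    (∀ (l : ℕ) [Fact l.Prime], l ≠ B.p → freeProlRank E.gal l = 1) ∧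
      @freeProlRank E.gal _ _ B.p B.instPrime = (Module.finrank ℚ_[B.p] B.K + 1 : ℕ) := by
  letI := B.instPrime
  refine ⟨fun l _ hl => ?_, ?_⟩
  · rw [freeProlRank_eq_of_continuousMulEquiv B.galIso l]
    exact (hR B.p B.K).1 l hl
  · rw [freeProlRank_eq_of_continuousMulEquiv B.galIso B.p]
    exact (hR B.p B.K).2

/-- [AbsTopI] Thm 2.6 (ii) "`ε¹_p(Π) = ∞`" for ANY extension `1 → Δ → Π → G → 1` with MLF base
data `G ≅ G_k`, GIVEN the rank formula `hR`: for every `n` there is an open subgroup `H ⊆ Π` with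
`n ≤ δ¹_p(H)` — the inverse image of an open `U ⊆ G_k` with `n ≤ δ¹_p(U)`, since `δ¹_p` does
not decrease along the continuous surjection `H ↠ U`. [cite: MochizukiAbsTopI2012, Thm 2.6 (ii) p.21] -/
theorem exists_isOpen_le_freeProlRank_of_rank
    (hR : ∀ (p : ℕ) [Fact p.Prime] (K : Type) [Field K] [Algebra ℚ_[p] K]
      [FiniteDimensional ℚ_[p] K],
      (∀ (l : ℕ) [Fact l.Prime], l ≠ p → freeProlRank (absoluteGaloisGroup K) l = 1) ∧
        freeProlRank (absoluteGaloisGroup K) p = (Module.finrank ℚ_[p] K + 1 : ℕ))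
    (n : ℕ) :
    ∃ H : Subgroup E.arith, IsOpen (H : Set E.arith) ∧
      (n : ℕ∞) ≤ @freeProlRank H _ _ B.p B.instPrime := by
  letI := B.instPrime
  obtain ⟨U, hUopen, hU⟩ := exists_isOpen_le_freeProlRank_absoluteGaloisGroup hR B.p B.K n
  -- `φ : Π ↠ G ≅ G_k`
  let φ : E.arith →* absoluteGaloisGroup B.K := (B.galIso.toMulEquiv.toMonoidHom).comp E.aug.toMonoidHom
  have hφc : Continuous φ := (map_continuous B.galIso).comp E.aug.continuous_toFun
  have hφs : Function.Surjective φ := B.galIso.surjective.comp E.aug_surjective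
  refine ⟨U.comap φ, hUopen.preimage hφc, le_trans hU ?_⟩
  -- the restriction `φ⁻¹(U) ↠ U`
  let ψ : ↥(U.comap φ) →* ↥U := (φ.restrict (U.comap φ)).codRestrict U fun x => x.2
  have hψc : Continuous ψ := Continuous.subtype_mk (hφc.comp continuous_subtype_val) _
  have hψs : Function.Surjective ψ := by
    rintro ⟨u, hu⟩
    obtain ⟨x, hx⟩ := hφs u
    exact ⟨⟨x, by rw [Subgroup.mem_comap, hx]; exact hu⟩, Subtype.ext hx⟩
  exact freeProlRank_le_of_surjective ⟨ψ, hψc⟩ hψs B.p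

/-- [AbsTopI] Thm 2.6 (ii) REDUCED to its `Π`-clauses, GIVEN the rank formula `hR`: for an
extension with MLF base data, `Thm26ii B S` holds as soon as "`Π` is topologically finitely
generated" and "the quantity `δ¹_l(Π) − δ¹_l(G)` is `= 0` if `l ∉ Σ`, and is independent of `l` if
`l ∈ Σ`" hold — the `G`-clauses and "`ε¹_p(Π) = ∞`" being consequences of `hR`.
[cite: MochizukiAbsTopI2012, Thm 2.6 (ii) p.21] -/
theorem thm26ii_of_rank
    (hR : ∀ (p : ℕ) [Fact p.Prime] (K : Type) [Field K] [Algebra ℚ_[p] K]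
      [FiniteDimensional ℚ_[p] K],
      (∀ (l : ℕ) [Fact l.Prime], l ≠ p → freeProlRank (absoluteGaloisGroup K) l = 1) ∧
        freeProlRank (absoluteGaloisGroup K) p = (Module.finrank ℚ_[p] K + 1 : ℕ))
    (S : Set ℕ) (htfg : IsTopologicallyFinitelyGenerated E.arith)
    (hoff : ∀ (l : ℕ) [Fact l.Prime], l ∉ S → freeProlRank E.arith l = freeProlRank E.gal l)
    (hon : ∀ (l₁ l₂ : ℕ) [Fact l₁.Prime] [Fact l₂.Prime], l₁ ∈ S → l₂ ∈ S →
      freeProlRank E.arith l₁ - freeProlRank E.gal l₁ =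
        freeProlRank E.arith l₂ - freeProlRank E.gal l₂) :
    E.Thm26ii B S :=
  ⟨htfg, (freeProlRank_gal_of_rank B hR).1, (freeProlRank_gal_of_rank B hR).2, hoff, hon,
    exists_isOpen_le_freeProlRank_of_rank B hR⟩

end FundamentalExtension

end Literature.AnabelianGeometry.AbsoluteAnabelian
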